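import Summits.NavierStokesRegularity.NavierStokesRegularity.Theorems.TypeICertificateLadderTargetFlowwiseDepletionSlab
import HarnessLib

/-!
# Crux `Target` = `TypeICertificateLadder.NoTypeIBlowup` (stmt-NavierStokesRegularity-1217), line
# `depletion-ladder`: the depleted enstrophy SLAB inequality with an ARBITRARY AMPLITUDE

`--supports stmt-NavierStokesRegularity-1217` (generalisation of the landed
`…TargetFlowwiseDepletionSlab.lean`: the amplitude in the depletion bound is decoupled from `sup|u|`).

On a Tao-class slab `[0, T] × ℝ³` assume, for some constant `κ` and some function `m : ℝ → ℝ` (no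
measurability, sign or continuity assumed), the depletion bound ALONG THE SOLUTION with amplitude `m`:
`|∫⟪ω(t), Du(t) ω(t)⟫| ≤ κ · m(t) · ‖ω(t)‖₂ · ‖∇ω(t)‖₂` for `t ∈ (0, T)` (`ω = curl u`). Then for
`0 < s ≤ T` with `∫₀ˢ m² < ∞`

  `∫‖curl u(s)‖² ≤ exp((κ²/(2ν)) ∫₀ˢ m(t)² dt) · ∫‖curl u(0)‖²`

(`lintegral_curl_sq_le_exp_of_amplitude`; proof verbatim the landed `lintegral_curl_sq_le_exp_of_flowwise`
with the slice sup norm replaced by `m(t)`: slice step `depleted_enstrophy_slice_of_amplitude` = the landed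
`depleted_enstrophy_slice_of_bound` at the rescaled constant `κ m(t)/M`, Grönwall
`Literature…lintegral_gronwall_le`, which needs no measurability). The point: the amplitude that the
depletion constant actually sees is Galilean (`…StrainCubeGalilean.lean`: `m(t) = sup_x |u(t,x) − c(t)|`
for any `c(t)`), and an INTEGRATED hypothesis on `m` is what the Grönwall consumes — the rungs built on
this file (`…AmplitudeRung.lean`) are stated in that currency.

WHAT THIS IS NOT: no depletion is proved here; conditional slab bookkeeping. [folklore]

References: Lemarié-Rieusset (2016), Thm. 11.2; Robinson–Rodrigo–Sadowski (2016), Lemma 8.16 / A.25.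
-/

noncomputable section

open Set Filter Topology MeasureTheory
open scoped RealInnerProductSpace ENNReal NNReal Laplacian ContDiff
open Literature.Analysis.FluidPDE

namespace Summit.NavierStokesRegularity.NavierStokesRegularity.Theorems.DepletionLadder

-- the problem directory repeats the summit name (`NavierStokesRegularity/NavierStokesRegularity`)
set_option linter.dupNamespace false

open Summit.NavierStokesRegularity.NavierStokesRegularity.Theorems.RungReynoldsOne
open Summit.NavierStokesRegularity.NavierStokesRegularity.Theorems.RungReynoldsOne.WeightedSlice

/-- **The depleted enstrophy slice inequality with an arbitrary amplitude.** Let `v` be smooth and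
divergence free with `ω = curl v`, `|v| ≤ M`, `‖Dv‖ ≤ B`, `Dv, D²v, D³v ∈ L²`, let `W` satisfy the
vorticity equation `curl W = νΔω − (v·∇)ω + (ω·∇)v`, and assume the depletion bound AT THIS FIELD with
amplitude `a` (any real number): `|∫ ⟪ω, Dv ω⟫| ≤ κ · a · ‖ω‖₂ · ‖∇ω‖₂`. Then
`∫ ⟪ω, curl W⟫ ≤ (κ²a²/(4ν)) ∫ ‖ω‖²` — the landed `depleted_enstrophy_slice_of_bound` at the constant
`κ a/(|M|+1)` and the bound `|M| + 1` of `|v|`. [folklore] -/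
theorem depleted_enstrophy_slice_of_amplitude {ν κ a : ℝ} (hν : 0 < ν)
    {v W : EuclideanSpace ℝ (Fin 3) → EuclideanSpace ℝ (Fin 3)} (hv : ContDiff ℝ ∞ v)
    (hdiv : VectorCalculus.IsDivFree v)
    (hcurl : ∀ x, curl W x = ν • (Δ (curl v)) x - convect v (curl v) x + convect (curl v) v x)
    {M B : ℝ} (hM : ∀ x, ‖v x‖ ≤ M) (hB : ∀ x, ‖fderiv ℝ v x‖ ≤ B)
    (h1 : ∫⁻ x, ‖iteratedFDeriv ℝ 1 v x‖ₑ ^ 2 < ⊤) (h2 : ∫⁻ x, ‖iteratedFDeriv ℝ 2 v x‖ₑ ^ 2 < ⊤)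
    (h3 : ∫⁻ x, ‖iteratedFDeriv ℝ 3 v x‖ₑ ^ 2 < ⊤)
    (hJ : |∫ x, ⟪curl v x, fderiv ℝ v x (curl v x)⟫| ≤
      κ * a * Real.sqrt (∫ x, ‖curl v x‖ ^ 2) *
        Real.sqrt (∫ x, frobeniusNormSq (fderiv ℝ (curl v) x))) :
    ∫ x, ⟪curl v x, curl W x⟫ ≤ κ ^ 2 * a ^ 2 / (4 * ν) * ∫ x, ‖curl v x‖ ^ 2 := by
  set M' : ℝ := |M| + 1 with hM'
  have hM'0 : 0 < M' := by positivity
  have hMv : ∀ x, ‖v x‖ ≤ M' := fun x => (hM x).trans ((le_abs_self M).trans (by linarith))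
  set κ' : ℝ := κ * a / M' with hκ'
  have hκM : κ' * M' = κ * a := by rw [hκ']; field_simp
  have hJ' : |∫ x, ⟪curl v x, fderiv ℝ v x (curl v x)⟫| ≤
      κ' * M' * Real.sqrt (∫ x, ‖curl v x‖ ^ 2) *
        Real.sqrt (∫ x, frobeniusNormSq (fderiv ℝ (curl v) x)) := by rw [hκM]; exact hJ
  have h := depleted_enstrophy_slice_of_bound hν hv hdiv hcurl hMv hB h1 h2 h3 hJ'
  have hsq : κ' ^ 2 * M' ^ 2 = κ ^ 2 * a ^ 2 := by
    rw [← mul_pow, ← mul_pow, hκM]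
  rwa [hsq] at h

/-- **The depleted enstrophy slab inequality with an arbitrary amplitude.** For a classical solution of
the unforced Navier–Stokes system with viscosity `ν > 0` on `[0, T] × ℝ³` with `u`, `∂ₜu` in Tao's
`L²`-Sobolev class, a constant `κ` and a function `m : ℝ → ℝ` such that for every `t ∈ (0,T)`
`|∫⟪curl u(t), Du(t) curl u(t)⟫| ≤ κ · m(t) · ‖curl u(t)‖₂ · ‖∇curl u(t)‖₂`, and `0 < s ≤ T` with
`∫₀ˢ m(t)² dt < ∞` (lower Lebesgue integral):
`∫ ‖curl u(s)‖² ≤ exp((κ²/(2ν)) ∫₀ˢ m(t)² dt) ∫ ‖curl u(0)‖²`. [folklore] -/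
theorem lintegral_curl_sq_le_exp_of_amplitude {ν κ T : ℝ} (hν : 0 < ν) (hT : 0 < T)
    {u : ℝ → EuclideanSpace ℝ (Fin 3) → EuclideanSpace ℝ (Fin 3)}
    {p : ℝ → EuclideanSpace ℝ (Fin 3) → ℝ} (hsol : IsClassicalNSSolutionOn (Icc 0 T) ν 0 u p)
    (hu : HasBoundedSobolevNormsOn (Icc 0 T) u)
    (hut : HasBoundedSobolevNormsOn (Icc 0 T) (timeDerivWithin (Icc 0 T) u))
    {m : ℝ → ℝ}
    (hdepl : ∀ t ∈ Ioo 0 T,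
      |∫ x, ⟪curl (u t) x, fderiv ℝ (u t) x (curl (u t) x)⟫| ≤
        κ * m t * Real.sqrt (∫ x, ‖curl (u t) x‖ ^ 2) *
          Real.sqrt (∫ x, frobeniusNormSq (fderiv ℝ (curl (u t)) x)))
    {s : ℝ} (hs : s ∈ Ioc 0 T)
    (hA : ∫⁻ t in Ioo 0 s, ENNReal.ofReal (m t ^ 2) ≠ ⊤) :
    ∫⁻ x, ‖curl (u s) x‖ₑ ^ 2 ≤
      ENNReal.ofReal (Real.exp (κ ^ 2 / (2 * ν) *
          (∫⁻ t in Ioo 0 s, ENNReal.ofReal (m t ^ 2)).toReal)) *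
        ∫⁻ x, ‖curl (u 0) x‖ₑ ^ 2 := by
  have hU : UniqueDiffOn ℝ (Icc 0 T) := uniqueDiffOn_Icc hT
  set W : ℝ → EuclideanSpace ℝ (Fin 3) → EuclideanSpace ℝ (Fin 3) :=
    timeDerivWithin (Icc 0 T) u with hW
  have hWsm : IsSmoothSpaceTimeOn (Icc 0 T) W := hsol.smooth_velocity.timeDerivWithin hU
  -- the vorticity family and its time derivative
  have hwsm : IsSmoothSpaceTimeOn (Icc 0 T) (vorticity u) :=
    hsol.smooth_velocity.isSmoothSpaceTimeOn_vorticity hU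
  have hwt : ∀ t ∈ Icc 0 T, ∀ x, timeDerivWithin (Icc 0 T) (vorticity u) t x = curl (W t) x :=
    fun t ht x => (hsol.smooth_velocity.curl_timeDerivWithin_of_uniqueDiffOn hU ht x).symm
  -- uniform bounds on the slab
  obtain ⟨B₀, hB₀0, hB₀⟩ := exists_forall_norm_le_of_hasBoundedSobolevNormsOn hsol hu
  obtain ⟨B₁, hB₁0, hB₁⟩ := exists_forall_norm_fderiv_le_of_hasBoundedSobolevNormsOn
    (fun t ht => (hsol.contDiff_velocity ht).of_le (by norm_cast)) hu
  obtain ⟨C₁, hC₁⟩ := hu 1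
  obtain ⟨C₂, hC₂⟩ := hu 2
  obtain ⟨C₃, hC₃⟩ := hu 3
  obtain ⟨E₁, hE₁⟩ := hut 1
  -- `L²` bounds of the vorticity and of its time derivative
  have hw0 : ∀ t ∈ Icc 0 T, ∫⁻ x, ‖vorticity u t x‖ₑ ^ 2 ≤ 6 * C₁ := by
    intro t ht
    calc ∫⁻ x, ‖vorticity u t x‖ₑ ^ 2 ≤ ∫⁻ x, 6 * ‖iteratedFDeriv ℝ 1 (u t) x‖ₑ ^ 2 :=
          lintegral_mono fun x => enorm_curl_sq_le_six_mul (u t) x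
      _ = 6 * ∫⁻ x, ‖iteratedFDeriv ℝ 1 (u t) x‖ₑ ^ 2 := lintegral_const_mul' _ _ (by norm_num)
      _ ≤ 6 * C₁ := by gcongr; exact hC₁ t ht
  have hw1 : ∀ t ∈ Icc 0 T,
      ∫⁻ x, ‖timeDerivWithin (Icc 0 T) (vorticity u) t x‖ₑ ^ 2 ≤ 6 * E₁ := by
    intro t ht
    calc ∫⁻ x, ‖timeDerivWithin (Icc 0 T) (vorticity u) t x‖ₑ ^ 2
        = ∫⁻ x, ‖curl (W t) x‖ₑ ^ 2 := lintegral_congr fun x => by rw [hwt t ht x]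
      _ ≤ ∫⁻ x, 6 * ‖iteratedFDeriv ℝ 1 (W t) x‖ₑ ^ 2 :=
          lintegral_mono fun x => enorm_curl_sq_le_six_mul (W t) x
      _ = 6 * ∫⁻ x, ‖iteratedFDeriv ℝ 1 (W t) x‖ₑ ^ 2 := lintegral_const_mul' _ _ (by norm_num)
      _ ≤ 6 * E₁ := by gcongr; exact hE₁ t ht
  -- the `L²` balance of the vorticity family
  obtain ⟨hΦint, -, hZb⟩ := hwsm.l2_balance hT (C₀ := 6 * C₁) (C₁ := 6 * E₁) hw0 hw1
  set Z : ℝ → ℝ := fun t => ∫ x, ‖vorticity u t x‖ ^ 2 with hZ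
  set Φ : ℝ → ℝ := fun t => ∫ x, 2 * ⟪vorticity u t x,
    timeDerivWithin (Icc 0 T) (vorticity u) t x⟫ with hΦ
  -- integrability and `ofReal` bookkeeping of the enstrophy slices
  have cvort : ∀ t ∈ Icc 0 T, Continuous (vorticity u t) := fun t ht =>
    (hwsm.contDiff_slice ht).continuous
  have hvort_lt : ∀ t ∈ Icc 0 T, ∫⁻ x, ‖vorticity u t x‖ₑ ^ 2 < ⊤ := fun t ht =>
    (hw0 t ht).trans_lt (ENNReal.mul_lt_top (by norm_num) ENNReal.coe_lt_top)
  have isq : ∀ t ∈ Icc 0 T, Integrable (fun x => ‖vorticity u t x‖ ^ 2) volume := fun t ht =>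
    integrable_sq_norm_of_lintegral_lt_top (cvort t ht) (hvort_lt t ht)
  have hZ0 : ∀ t, 0 ≤ Z t := fun t => integral_nonneg fun x => sq_nonneg _
  have hZeq : ∀ t ∈ Icc 0 T, ENNReal.ofReal (Z t) = ∫⁻ x, ‖curl (u t) x‖ₑ ^ 2 := fun t ht => by
    rw [hZ]
    exact ofReal_integral_sq_norm (isq t ht)
  -- THE SLICE BOUND at interior times: `Φ t ≤ (κ²/(2ν)) m(t)² Z t`
  have hslice : ∀ t ∈ Ioo 0 T, Φ t ≤ κ ^ 2 / (2 * ν) * m t ^ 2 * Z t := by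
    intro t ht
    have htI : t ∈ Icc 0 T := Ioo_subset_Icc_self ht
    have hZt : ∀ x, curl (W t) x = ν • (Δ (curl (u t))) x - convect (u t) (curl (u t)) x +
        convect (curl (u t)) (u t) x := by
      intro x
      have h := hsol.curl_timeDerivWithin_eq hU htI x
      rw [show ((0 : ℝ → EuclideanSpace ℝ (Fin 3) → EuclideanSpace ℝ (Fin 3)) t) = 0 from rfl,
        curl_zero, add_zero] at h
      exact h
    have h1 : ∫⁻ x, ‖iteratedFDeriv ℝ 1 (u t) x‖ₑ ^ 2 < ⊤ := (hC₁ t htI).trans_lt ENNReal.coe_lt_top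
    have h2 : ∫⁻ x, ‖iteratedFDeriv ℝ 2 (u t) x‖ₑ ^ 2 < ⊤ := (hC₂ t htI).trans_lt ENNReal.coe_lt_top
    have h3 : ∫⁻ x, ‖iteratedFDeriv ℝ 3 (u t) x‖ₑ ^ 2 < ⊤ := (hC₃ t htI).trans_lt ENNReal.coe_lt_top
    have hsl := depleted_enstrophy_slice_of_amplitude hν (hsol.contDiff_velocity htI)
      (hsol.divFree t htI) hZt (hB₀ t htI) (hB₁ t htI) h1 h2 h3 (hdepl t ht)
    -- rewrite `Φ t` in terms of `curl (W t)`
    have hΦt : Φ t = 2 * ∫ x, ⟪curl (u t) x, curl (W t) x⟫ := by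
      rw [hΦ]
      simp only
      rw [← integral_const_mul]
      refine integral_congr_ae (Eventually.of_forall fun x => ?_)
      simp only [vorticity_apply, hwt t htI x]
    have hZt' : ∫ x, ‖curl (u t) x‖ ^ 2 = Z t := by
      rw [hZ]
      simp only [vorticity_apply]
    calc Φ t = 2 * ∫ x, ⟪curl (u t) x, curl (W t) x⟫ := hΦt
      _ ≤ 2 * (κ ^ 2 * m t ^ 2 / (4 * ν) * ∫ x, ‖curl (u t) x‖ ^ 2) :=
          mul_le_mul_of_nonneg_left hsl (by norm_num)
      _ = κ ^ 2 / (2 * ν) * m t ^ 2 * Z t := by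
          rw [hZt']
          field_simp
          ring
  -- Grönwall in `ℝ≥0∞`
  set φE : ℝ → ℝ≥0∞ := fun t => ENNReal.ofReal (Z t) with hφE
  set kν : ℝ := κ ^ 2 / (2 * ν) with hkν
  have hk0 : 0 ≤ kν := by positivity
  set aE : ℝ → ℝ≥0∞ := fun t => ENNReal.ofReal kν * ENNReal.ofReal (m t ^ 2) with haE
  have hM : ∀ t ∈ Icc 0 s, φE t ≤ 6 * C₁ := fun t ht => by
    rw [hφE]
    simp only
    rw [hZeq t ⟨ht.1, ht.2.trans hs.2⟩]
    exact hw0 t ⟨ht.1, ht.2.trans hs.2⟩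
  have haS : ∫⁻ t in Ioo 0 s, aE t ≠ ⊤ := by
    rw [haE]
    simp only
    rw [lintegral_const_mul' _ _ ENNReal.ofReal_ne_top]
    exact ENNReal.mul_ne_top ENNReal.ofReal_ne_top hA
  have hineq : ∀ t ∈ Icc 0 s, φE t ≤ φE 0 + ∫⁻ τ in Ioo 0 t, aE τ * φE τ := by
    intro t ht
    rcases eq_or_lt_of_le ht.1 with h0 | ht0
    · rw [← h0]; simp
    have htT : t ∈ Ioc 0 T := ⟨ht0, ht.2.trans hs.2⟩
    have hΦt : IntegrableOn Φ (Ioo 0 t) volume := hΦint.mono_set (Ioo_subset_Ioo le_rfl htT.2)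
    have h1 : ENNReal.ofReal (∫ τ in Ioo 0 t, Φ τ) ≤ ∫⁻ τ in Ioo 0 t, ENNReal.ofReal (Φ τ) := by
      calc ENNReal.ofReal (∫ τ in Ioo 0 t, Φ τ) ≤ ENNReal.ofReal (∫ τ in Ioo 0 t, max (Φ τ) 0) :=
            ENNReal.ofReal_le_ofReal (integral_mono hΦt hΦt.pos_part fun τ => le_max_left _ _)
        _ = ∫⁻ τ in Ioo 0 t, ENNReal.ofReal (max (Φ τ) 0) :=
            ofReal_integral_eq_lintegral_ofReal hΦt.pos_part
              (Eventually.of_forall fun τ => le_max_right _ _)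
        _ = ∫⁻ τ in Ioo 0 t, ENNReal.ofReal (Φ τ) := lintegral_congr fun τ => by
            rcases le_total (Φ τ) 0 with h | h
            · rw [max_eq_right h, ENNReal.ofReal_zero, ENNReal.ofReal_of_nonpos h]
            · rw [max_eq_left h]
    have h2 : ∫⁻ τ in Ioo 0 t, ENNReal.ofReal (Φ τ) ≤ ∫⁻ τ in Ioo 0 t, aE τ * φE τ := by
      refine setLIntegral_mono' measurableSet_Ioo fun τ hτ => ?_
      have hτT : τ ∈ Ioo 0 T := ⟨hτ.1, hτ.2.trans_le htT.2⟩
      calc ENNReal.ofReal (Φ τ) ≤ ENNReal.ofReal (kν * m τ ^ 2 * Z τ) :=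
            ENNReal.ofReal_le_ofReal (by simpa [hkν, mul_assoc] using hslice τ hτT)
        _ = aE τ * φE τ := by
            rw [haE, hφE]
            simp only
            rw [ENNReal.ofReal_mul (mul_nonneg hk0 (sq_nonneg _)), ENNReal.ofReal_mul hk0]
    calc φE t = ENNReal.ofReal (Z 0 + ∫ τ in (0 : ℝ)..t, Φ τ) := by
          rw [hφE]
          simp only
          congr 1
          exact hZb t htT
      _ ≤ ENNReal.ofReal (Z 0) + ENNReal.ofReal (∫ τ in (0 : ℝ)..t, Φ τ) := ENNReal.ofReal_add_le
      _ = φE 0 + ENNReal.ofReal (∫ τ in Ioo 0 t, Φ τ) := by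
          rw [intervalIntegral.integral_of_le ht.1, integral_Ioc_eq_integral_Ioo]
      _ ≤ φE 0 + ∫⁻ τ in Ioo 0 t, aE τ * φE τ := by gcongr; exact h1.trans h2
  have hgron := lintegral_gronwall_le (S := s) ENNReal.ofReal_ne_top
    (ENNReal.mul_ne_top (by norm_num) ENNReal.coe_ne_top) hM haS hineq s ⟨hs.1.le, le_rfl⟩
  -- unpack
  have hint_a : (∫⁻ τ in Ioo 0 s, aE τ).toReal =
      kν * (∫⁻ t in Ioo 0 s, ENNReal.ofReal (m t ^ 2)).toReal := by
    rw [haE]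
    simp only
    rw [lintegral_const_mul' _ _ ENNReal.ofReal_ne_top, ENNReal.toReal_mul, ENNReal.toReal_ofReal hk0]
  rw [hint_a] at hgron
  rw [← hZeq s ⟨hs.1.le, hs.2⟩, ← hZeq 0 ⟨le_rfl, hT.le⟩, mul_comm]
  convert hgron using 3

end Summit.NavierStokesRegularity.NavierStokesRegularity.Theorems.DepletionLadder

end
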